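import Literature.NumberTheory.EllipticCurves.Rank1Residual.Typed.HigherDescentSelmerCertificate
import HarnessLib

/-!
# Class X5 (`p = 2`, every `E/ℚ` of analytic rank `≤ 1`) — the DESCENT ROUTE through the typed residue (cell `b2b-bsdres`, unit `b2b-bsdres-sha-1`, gen 5)

Placement: beside its siblings `Typed/X5.lean`, `Typed/HigherDescentCertificate.lean` (p193410) and
`Typed/HigherDescentSelmerCertificate.lean` (p193871), which it packages; every declaration is either
a PREDICATE (shape cited, nothing asserted) or PROVED here from Mathlib + those files (`[cite:]` =
the published statement whose shape / content the declaration transcribes; `[folklore]` only on the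
two private content-free group-theory helpers).

HONEST FRAMING (run/shared/lean/b2b/bsd-rank1-residual/, verbatim in every file): the goal of the
cell is to DELETE the COMBINATION-SHAPED residual classes of the Birch–Swinnerton-Dyer formula for
ALL analytic-rank `≤ 1` elliptic curves over `ℚ` — "full BSD formula for every rank `≤ 1` curve in
class `C`" assembled STRICTLY from published theorems — so that the rank-`≤ 1` remainder becomes
exactly the CONSTRUCTION-SHAPED classes, which are TYPED (missing-input `Prop`s), NOT attempted.
This is not "finishing BSD". Unit `b2b-bsdres-sha-1` = prover OWNER of class X5 (`p = 2`, every
`E`; HOME/CLASS-OWNERS.md): prove what is provable now; shrink the class to its core with data; no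
claim beyond the stated class. X5 stays CONSTRUCTION-SHAPED; nothing here is a named fact; nothing
here changes a label; no `sorry`.

## The route in one statement

`X5 = (p = 2)` (`Rank1Residual.ClassX5 W p := p = 2`), analytic rank `≤ 1`. Its typed residue is the
whole `2`-part output `Typed.X5.MissingInputAt W 2 := MissingPPartAt W 2` ("`#Ш(E/ℚ)_an` is a
rational `q` with `ord₂ q = ord₂ #Ш(E/ℚ)`", Miller's last clause of `BSD(E,2)`): no `2`-adic main
conjecture with control exists for a general `E/ℚ` (`Typed/X5.lean`). The route of this unit is the
classical one — PER CURVE, a finite tower of `2`-power descents: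

* **the certified descent datum at `(E, 2)`** (`X5.DescentCertificateAt W`): a LEVEL `k`, an EXPONENT
  `m` and three finite statements — (i) STABILISATION `Ш(E/ℚ)[2^(k+1)] = Ш(E/ℚ)[2^k]` (no element
  of exact order `2^k` is twice an element of `Ш`; at `k = 1` the output of the Cassels–Tate pairing
  on `Sel^(2)` / an explicit `4`-descent, at `k = 2` the output of an `8`-descent — every fake
  `2`-Selmer set of the `4`-coverings of exact order `4` EMPTY, Stamminger 2005 Thm. 6.2.2 — or of
  the Cassels–Tate pairing on `Sel^(4) × Sel^(2)`, Swinnerton-Dyer 2013), (ii) the COUNT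
  `#Ш(E/ℚ)[2^k] = 2^m` (from `#Sel^(2^k)(E/ℚ)`, `rank E(ℚ)` and `#E(ℚ)[2^k]` by the fundamental
  exact sequence, Silverman X.4.2 — tree `card_selmerGroup_eq_pow_rank_mul`, PROVED), (iii) the
  PREDICTION `#Ш(E/ℚ)_an = q ∈ ℚ` with `ord₂ q = m` (Manin's modular symbols, exact);
* **per curve** (`X5.missingInputAt_of_descentCertificateAt`): granted `Ш(E/ℚ)` finite (in analytic
  rank `≤ 1`: Gross–Zagier–Kolyvagin, bsd.S17, binder `hGZK`), the datum DISCHARGES the typed residue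
  at `(E, 2)` — `Typed.missingPPartAt_of_stable` (p193410) — hence `BSD(E,2)`
  (`X5.bsdp_two_of_descentCertificateAt`); and CONVERSELY (`X5.descentCertificateAt_of_missingInputAt`)
  the typed residue at `(E, 2)` gives back a datum (level `#Ш`, exponent `ord₂ #Ш`): the datum is
  EXACTLY as strong as the residue, per curve (`X5.descentCertificateAt_iff_missingInputAt`) — the
  route neither weakens X5 nor smuggles anything in; it LOCALISES the class statement into finite,
  machine-certifiable data, one curve at a time;
* **class level** (`X5.bsdp_of_forall_descentCertificate`): `hGZK` + "every `E/ℚ` of analytic rank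
  `≤ 1` has a certified descent datum at `2`" ⟹ `BSD(E,2)` for every pair of X5; and the class
  statement implies the universal datum back (`X5.forall_descentCertificate_of_forall_bsdp_two`). The
  universally quantified datum is an OPEN PROBLEM (no algorithm is known to terminate: it is the
  finiteness of `Ш(E/ℚ)[2^∞]` made effective); it is a ROUTE INPUT, never a fact.

## The three engine shapes of the datum (what the lane's instruments output, typed)

* SHARP `2`-descent (census tiers T-2DESC / A / B / F; `24 347` of the `24 422` residual curves with
  `N < 2·10⁴`, SHA-CENSUS.md §4): `k = 1`: `#E(ℚ)[2] = 2^t`, `#Sel^(2) = 2^(r+t+s)`, `Ш[4] = Ш[2]`,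
  `ord₂ #Ш_an = s` — `X5.descentCertificateAt_of_selmerTwo` (Selmer currency, tree
  `X5.bsdp_two_of_card_selmerTwo`, p193871) / `descentCertificateAt_of_level_one`.
* CORE, structure-free (`8`-descent, engine H mode S; SHA-CENSUS.md §5): the `8`-descent verdict
  "no element of `Ш` of exact order `4` is divisible by `2`" IS `Ш[8] = Ш[4]`
  (`stable_four_of_forall_not_divisible`, the `k = 1` case of tree
  `stable_succ_iff_forall_divisible`); with `#Ш[4] = 16` and `ord₂ #Ш_an = 4`:
  `X5.descentCertificateAt_of_eightDescent`.
* CORE, with the structure input (engine G = Cassels–Tate on `Sel^(4) × Sel^(2)`; engine H mode A):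
  both read ONE witness — an element `η ∈ Ш[4]` of exact order `4` that is NOT twice an element —
  through the DICHOTOMY "either no element of exact order `4` is `2`-divisible, or every element of
  `Ш[4]` is" (`TwoDivisibilityDichotomy`), which holds because `Ш(E)[2^∞] ≅ (ℤ/2^k)²` (finite by
  GZK; Cassels' alternating pairing with trivial kernel on a finite group, Silverman X.4.14 = tree
  named fact `exists_casselsTate_pairing`, forces a symplectic shape `B × B`; `Ш[2] ≅ (ℤ/2)²` makes
  `B` cyclic). The dichotomy is a TYPED INPUT here (explicit hypothesis; its derivation from the named
  fact is finite-abelian-group algebra not yet in the tree): `stable_four_of_dichotomy_of_witness`,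
  `descentCertificateAt_of_dichotomy`. The `#Ш[4] = 16` line of the core is the `4`-descent output
  "`#Ш[2] = 4` and every element of `Ш[2]` is twice an element of `Ш[4]`" (all three non-trivial
  `2`-coverings lift to everywhere locally soluble `4`-coverings): `card_torsionBy_four_of_two_divisible`.

Census instantiation (data + in-kernel recheck of the bookkeeping, engines' certificates as the
evidence): companion file `Typed/X5DescentRecords.lean`. NOT here: any Selmer group evaluation, pairing
or covering — those are the engines (PARI `ellrank`; the lane's `desc2lib.gp`, `desc4lib.gp`,
`ctlib.gp`, `desc8lib.gp`; Magma-free), whose outputs enter as the hypotheses named above.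

References: Silverman *AEC* X.4.2, X.4.14 [SilvermanAEC2009]; Cassels 1998 §1 [Cassels1998];
Merriman–Siksek–Smart 1996 §4 [MerrimanSiksekSmart1996]; Stamminger 2005 Thm. 6.2.2
[Stamminger2005]; Swinnerton-Dyer 2013 [SwinnertonDyer2013]; Miller 2011 §1, Def. 1.1
[Miller2011LMS]; Creutz–Miller 2012 Thm. 1.1 [CreutzMiller2012]; Cremona *Algorithms* §3.6
[Cremona1997]; cell files `b2b-bsdres-sha-1/SHA-CENSUS.md`, `Typed/X5.lean`,
`Typed/HigherDescentCertificate.lean`, `Typed/HigherDescentSelmerCertificate.lean`.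
-/

noncomputable section

open scoped Classical

open WeierstrassCurve Literature.NumberTheory.EllipticCurves
  Literature.NumberTheory.EllipticCurves.Rank1Residual
  Literature.NumberTheory.EllipticCurves.Rank1Residual.Typed

namespace Literature.NumberTheory.EllipticCurves.Rank1Residual.Typed

/-! ### §1 Algebra: `2`-divisibility of the `4`-torsion of an abelian group -/

section Algebra

variable {A : Type*} [AddCommGroup A]

/-- **The `8`-descent verdict IS `A[8] = A[4]`** (engine H, mode S, structure-free): if no element
`y` of exact order `4` is twice an element (`y = 2·x` and `4·y = 0` force `2·y = 0`), then every
element killed by `8` is killed by `4` (apply the hypothesis to `y = 2·x`). For `A = Ш(E/ℚ)`: a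
`4`-covering of exact order `4` is twice an element of `Ш` iff it admits an everywhere locally
soluble `2`-covering, which an EMPTY fake `2`-Selmer set excludes. The `k = 1` instance of tree
`Typed.stable_succ_iff_forall_divisible`. [cite: Stamminger2005, Thm. 6.2.2 (p. 73)] -/
theorem stable_four_of_forall_not_divisible
    (h : ∀ y : A, (∃ x : A, 2 • x = y) → 4 • y = 0 → 2 • y = 0) :
    ∀ x : A, 8 • x = 0 → 4 • x = 0 := by
  intro x hx
  have e8 : (4 * 2) • x = 8 • x := by norm_num
  have e4 : (2 * 2) • x = 4 • x := by norm_num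
  have hy4 : 4 • (2 • x) = 0 := by rw [smul_smul, e8, hx]
  have h2 := h (2 • x) ⟨x, rfl⟩ hy4
  rw [smul_smul, e4] at h2
  exact h2

/-- Conversely `A[8] = A[4]` says that no element of exact order `4` is twice an element.
Bookkeeping (the other direction of the dictionary); private helper. [folklore] -/
private theorem forall_not_divisible_of_stable_four (h : ∀ x : A, 8 • x = 0 → 4 • x = 0) :
    ∀ y : A, (∃ x : A, 2 • x = y) → 4 • y = 0 → 2 • y = 0 := by
  rintro y ⟨x, rfl⟩ hy
  have e8 : (4 * 2) • x = 8 • x := by norm_num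
  have e4 : (2 * 2) • x = 4 • x := by norm_num
  have hx8 : 8 • x = 0 := by rw [← e8, ← smul_smul]; exact hy
  rw [smul_smul, e4]
  exact h x hx8

/-- **The structure input of engines G and H-mode-A, typed**: EITHER no element of exact order `4`
of `A` is twice an element, OR every element of `A[4]` is. For `A = Ш(E/ℚ)[2^∞] ≅ (ℤ/2^k)²`
(finite `Ш` with Cassels' alternating pairing, Silverman X.4.14, and `Ш[2] ≅ (ℤ/2)²`) this holds
with the first branch iff `k = 2`: in a homocyclic group an element is `2`-divisible iff its order is
`< 2^k`. A predicate (explicit hypothesis below); nothing asserted.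
[cite: SilvermanAEC2009, Thm. X.4.14 "in particular" (shape only; nothing asserted)]
[cite: SwinnertonDyer2013, §1 (shape only; nothing asserted)] -/
def TwoDivisibilityDichotomy (A : Type*) [AddCommGroup A] : Prop :=
  (∀ y : A, 4 • y = 0 → 2 • y ≠ 0 → ¬ ∃ x : A, 2 • x = y) ∨
    (∀ y : A, 4 • y = 0 → ∃ x : A, 2 • x = y)

/-- **One witness decides under the dichotomy** (engine G `m = 1`; engine H mode A): an element
`η` with `4·η = 0`, `2·η ≠ 0` that is NOT twice an element rules out the second branch, and the
first branch is `A[8] = A[4]` (`stable_four_of_forall_not_divisible`).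
[cite: SwinnertonDyer2013, §1] [cite: Stamminger2005, Thm. 6.2.2 (p. 73)] -/
theorem stable_four_of_dichotomy_of_witness (hd : TwoDivisibilityDichotomy A)
    (hη : ∃ η : A, 4 • η = 0 ∧ 2 • η ≠ 0 ∧ ¬ ∃ x : A, 2 • x = η) :
    ∀ x : A, 8 • x = 0 → 4 • x = 0 := by
  obtain ⟨η, h4, h2, hnd⟩ := hη
  rcases hd with hnone | hall
  · refine stable_four_of_forall_not_divisible fun y hy hy4 => ?_
    by_contra hy2
    exact hnone y hy4 hy2 hy
  · exact absurd (hall η h4) hnd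

/-- **`#A[4] = (#A[2])²` when every element of `A[2]` is twice an element** (the `4`-descent output
on the X5 core: all three non-trivial `2`-coverings lift to everywhere locally soluble
`4`-coverings, i.e. `Ш[2] ⊆ 2·Ш[4]`): multiplication by `2` maps `A[4]` ONTO `A[2]` with kernel
`A[2]`. [cite: MerrimanSiksekSmart1996, §4] [cite: SilvermanAEC2009, Thm X.4.2(a)] -/
theorem card_torsionBy_four_of_two_divisible {n : ℕ}
    (h2 : Nat.card (AddSubgroup.torsionBy A 2) = n)
    (hdiv : ∀ y : A, 2 • y = 0 → ∃ x : A, 2 • x = y) :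
    Nat.card (AddSubgroup.torsionBy A 4) = n * n := by
  -- the doubling map on `A[4]`
  let f : AddSubgroup.torsionBy A 4 →+ A := (nsmulAddMonoidHom 2).comp (AddSubgroup.torsionBy A 4).subtype
  have hf : ∀ x : AddSubgroup.torsionBy A 4, f x = 2 • (x : A) := fun x => rfl
  have hmem4 : ∀ x : A, x ∈ AddSubgroup.torsionBy A 4 ↔ 4 • x = 0 := fun x =>
    AddSubgroup.torsionBy.nsmul_iff (n := 4)
  have hmem2 : ∀ x : A, x ∈ AddSubgroup.torsionBy A 2 ↔ 2 • x = 0 := fun x =>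
    AddSubgroup.torsionBy.nsmul_iff (n := 2)
  -- its range is `A[2]`
  have hrange : f.range = AddSubgroup.torsionBy A 2 := by
    ext y
    rw [AddMonoidHom.mem_range, hmem2]
    constructor
    · rintro ⟨x, rfl⟩
      rw [hf, smul_smul]
      have e4 : (2 * 2) • (x : A) = 4 • (x : A) := by norm_num
      rw [e4]
      exact (hmem4 x).1 x.2
    · intro hy
      obtain ⟨x, rfl⟩ := hdiv y hy
      have hx4 : 4 • x = 0 := by
        have e4 : (2 * 2) • x = 4 • x := by norm_num
        rw [← e4, ← smul_smul]; exact hy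
      exact ⟨⟨x, (hmem4 x).2 hx4⟩, rfl⟩
  -- its kernel is `A[2]` seen inside `A[4]`
  have hle : AddSubgroup.torsionBy A 2 ≤ AddSubgroup.torsionBy A 4 := by
    intro x hx
    rw [hmem2] at hx
    rw [hmem4]
    have e4 : (2 * 2) • x = 4 • x := by norm_num
    rw [← e4, ← smul_smul, hx, smul_zero]
  have hker : f.ker = (AddSubgroup.torsionBy A 2).addSubgroupOf (AddSubgroup.torsionBy A 4) := by
    ext x
    rw [AddMonoidHom.mem_ker, AddSubgroup.mem_addSubgroupOf, hmem2, hf]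
  have hcker : Nat.card f.ker = n := by
    rw [hker, Nat.card_congr (AddSubgroup.addSubgroupOfEquivOfLe hle).toEquiv, h2]
  have hcrange : Nat.card f.range = n := by rw [hrange, h2]
  have hmul := f.ker.card_mul_index
  rw [AddSubgroup.index_ker, hcker, hcrange] at hmul
  exact hmul.symm

/-- **A finite abelian group stabilises at level `#A`**: if `p^(n+1)·x = 0` with `n = #A`, then the
order of `x` is a power `p^j` dividing `#A = n < p^n`, so `j < n` and `p^n·x = 0`. (Used for the
converse direction: the typed residue hands back a certificate.) Private helper. [folklore] -/
private theorem stable_at_card [Finite A] {p : ℕ} (hp : p.Prime) :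
    ∀ x : A, p ^ (Nat.card A + 1) • x = 0 → p ^ Nat.card A • x = 0 := by
  intro x hx
  have hord : addOrderOf x ∣ p ^ (Nat.card A + 1) := addOrderOf_dvd_iff_nsmul_eq_zero.2 hx
  obtain ⟨j, -, hj⟩ := (Nat.dvd_prime_pow hp).1 hord
  have hdvd : addOrderOf x ∣ Nat.card A := addOrderOf_dvd_natCard x
  have hpos : 0 < Nat.card A := Nat.card_pos
  have hle : p ^ j ≤ Nat.card A := by rw [← hj]; exact Nat.le_of_dvd hpos hdvd
  have hlt : Nat.card A < p ^ Nat.card A :=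
    lt_of_lt_of_le Nat.lt_two_pow_self (Nat.pow_le_pow_left hp.two_le _)
  have hjn : j < Nat.card A := (Nat.pow_lt_pow_iff_right hp.one_lt).1 (lt_of_le_of_lt hle hlt)
  apply addOrderOf_dvd_iff_nsmul_eq_zero.1
  rw [hj]
  exact pow_dvd_pow p hjn.le

end Algebra

/-! ### §2 The certified descent datum at `(E, 2)` and the per-curve bridge -/

section PerCurve

variable (W : WeierstrassCurve ℚ)

/-- **The certified descent datum at `(E, 2)`** (the route's per-curve input, Ш-currency): a level
`k` and an exponent `m` with (i) `Ш(E/ℚ)[2^(k+1)] = Ш(E/ℚ)[2^k]`, (ii) `#Ш(E/ℚ)[2^k] = 2^m`,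
(iii) `#Ш(E/ℚ)_an = q ∈ ℚ` with `ord₂ q = m`. Each line is the output of a terminating computation
on the curve (a `2^(k+1)`-descent resp. a Cassels–Tate pairing for (i); `#Sel^(2^k)`, the rank and
`#E(ℚ)[2^k]` for (ii); modular symbols for (iii)); the datum's EXISTENCE for every `E` is open. A
predicate; nothing asserted. [cite: Miller2011LMS, §1 and Def. 1.1 (shape only; nothing asserted)]
[cite: Stamminger2005, Thm. 6.2.2 (p. 73) (shape only; nothing asserted)] -/
def X5.DescentCertificateAt (W : WeierstrassCurve ℚ) : Prop :=
  ∃ k m : ℕ, (∀ x : W.sha, 2 ^ (k + 1) • x = 0 → 2 ^ k • x = 0) ∧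
    Nat.card (AddSubgroup.torsionBy W.sha (2 ^ k : ℕ)) = 2 ^ m ∧
    ∃ q : ℚ, shaAn W = (q : ℂ) ∧ padicValRat 2 q = m

/-- **Per curve: the datum discharges the typed residue of X5 at `(E, 2)`** (`Ш` finite):
`Typed.missingPPartAt_of_stable`. [cite: Miller2011LMS, §1 and Def. 1.1] -/
theorem X5.missingInputAt_of_descentCertificateAt (hfin : W.ShaFinite)
    (h : X5.DescentCertificateAt W) : Typed.X5.MissingInputAt W 2 := by
  haveI : Fact (Nat.Prime 2) := ⟨Nat.prime_two⟩
  obtain ⟨k, m, hstab, hcard, q, hq, hv⟩ := h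
  exact missingPPartAt_of_stable W 2 hfin hstab hcard hq hv

/-- **Per curve, conversely: the typed residue hands back a datum** (`Ш` finite): level
`k = #Ш(E/ℚ)` (`stable_at_card`), exponent `m = ord₂ #Ш(E/ℚ)`
(`card_torsionBy_eq_pow_padicValNat_of_stable`). So `DescentCertificateAt` is not STRONGER than the
residue. [cite: Miller2011LMS, Def. 1.1] -/
theorem X5.descentCertificateAt_of_missingInputAt (hfin : W.ShaFinite)
    (h : Typed.X5.MissingInputAt W 2) : X5.DescentCertificateAt W := by
  haveI : Finite W.sha := hfin
  haveI : Fact (Nat.Prime 2) := ⟨Nat.prime_two⟩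
  obtain ⟨q, hq, hv⟩ := h
  have hstab : ∀ x : W.sha, 2 ^ (Nat.card W.sha + 1) • x = 0 → 2 ^ Nat.card W.sha • x = 0 :=
    stable_at_card Nat.prime_two
  refine ⟨Nat.card W.sha, padicValNat 2 W.shaOrder, hstab, ?_, q, hq, by rw [hv]⟩
  rw [card_torsionBy_eq_pow_padicValNat_of_stable hstab, WeierstrassCurve.shaOrder]

/-- **Per curve: datum ⟺ typed residue** (`Ш` finite). The route localises X5 exactly.
[cite: Miller2011LMS, Def. 1.1] -/
theorem X5.descentCertificateAt_iff_missingInputAt (hfin : W.ShaFinite) :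
    X5.DescentCertificateAt W ↔ Typed.X5.MissingInputAt W 2 :=
  ⟨X5.missingInputAt_of_descentCertificateAt W hfin, X5.descentCertificateAt_of_missingInputAt W hfin⟩

variable [W.IsElliptic] [W.IsGloballyMinimal]

/-- **Per curve: datum ⇒ `BSD(E,2)`** in analytic rank `≤ 1` (GZK `hGZK` for finiteness and
`rank = r_an`), through the conditional class theorem `Typed.X5.bsdp_of_missingInputAt`.
[cite: Miller2011LMS, §1 and Def. 1.1] -/
theorem X5.bsdp_two_of_descentCertificateAt (hGZK : rank_eq_analyticRank_of_analyticRank_le_one)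
    (hr : W.analyticRank ≤ 1) (h : X5.DescentCertificateAt W) : BSDp W 2 :=
  haveI : Fact (Nat.Prime 2) := ⟨Nat.prime_two⟩
  X5.bsdp_of_missingInputAt hGZK W 2 hr rfl
    (X5.missingInputAt_of_descentCertificateAt W (hGZK W hr).2 h)

omit [W.IsElliptic] [W.IsGloballyMinimal] in
/-- **Per curve, conversely: `BSD(E,2)` ⇒ datum** (finite `Ш`). [cite: Miller2011LMS, Def. 1.1] -/
theorem X5.descentCertificateAt_of_bsdp_two [Finite W.sha] (h : BSDp W 2) : X5.DescentCertificateAt W :=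
  haveI : Fact (Nat.Prime 2) := ⟨Nat.prime_two⟩
  X5.descentCertificateAt_of_missingInputAt W ‹Finite W.sha› (missingPPartAt_of_bsdp W 2 h)

end PerCurve

/-! ### §3 The three engine shapes of the datum -/

section Shapes

variable (W : WeierstrassCurve ℚ)

/-- **Level-`k` constructor** (any `k`, `m`): the three certificate lines as separate binders.
[cite: Miller2011LMS, Def. 1.1] -/
theorem X5.descentCertificateAt_of_level {k m : ℕ}
    (hstab : ∀ x : W.sha, 2 ^ (k + 1) • x = 0 → 2 ^ k • x = 0)
    (hcard : Nat.card (AddSubgroup.torsionBy W.sha (2 ^ k : ℕ)) = 2 ^ m)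
    {q : ℚ} (hq : shaAn W = (q : ℂ)) (hv : padicValRat 2 q = m) : X5.DescentCertificateAt W :=
  ⟨k, m, hstab, hcard, q, hq, hv⟩

/-- **SHARP shape** (`k = 1`; census tiers T-2DESC/A/B/F, `Ш[4] = Ш[2]` by the Cassels–Tate pairing
on `Sel^(2)` or an explicit `4`-descent): `Ш[4] = Ш[2]`, `#Ш[2] = 2^s`, `ord₂ #Ш_an = s`.
[cite: Cassels1998, §1] [cite: MerrimanSiksekSmart1996, §4] -/
theorem X5.descentCertificateAt_of_level_one (hstab : ∀ x : W.sha, 4 • x = 0 → 2 • x = 0) {s : ℕ}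
    (hcard : Nat.card (AddSubgroup.torsionBy W.sha 2) = 2 ^ s)
    {q : ℚ} (hq : shaAn W = (q : ℂ)) (hv : padicValRat 2 q = s) : X5.DescentCertificateAt W := by
  refine X5.descentCertificateAt_of_level W (k := 1) (m := s) (fun x hx => ?_) (by simpa using hcard) hq hv
  have h4 : 4 • x = 0 := by simpa using hx
  simpa using hstab x h4

/-- **CORE shape, structure-free** (`k = 2`; engine H mode S): the `8`-descent verdict "no element of
exact order `4` of `Ш(E/ℚ)` is twice an element", `#Ш[4] = 16`, `ord₂ #Ш_an = 4`.
[cite: Stamminger2005, Thm. 6.2.2 (p. 73)] -/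
theorem X5.descentCertificateAt_of_eightDescent
    (hH : ∀ y : W.sha, (∃ x : W.sha, 2 • x = y) → 4 • y = 0 → 2 • y = 0)
    (hcard : Nat.card (AddSubgroup.torsionBy W.sha 4) = 16)
    {q : ℚ} (hq : shaAn W = (q : ℂ)) (hv : padicValRat 2 q = 4) : X5.DescentCertificateAt W := by
  have hstab := stable_four_of_forall_not_divisible hH
  refine X5.descentCertificateAt_of_level W (k := 2) (m := 4) (fun x hx => ?_) (by simpa using hcard) hq
    (by exact_mod_cast hv)
  have h8 : 8 • x = 0 := by simpa using hx
  simpa using hstab x h8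

/-- **CORE shape with the structure input** (`k = 2`; engine G = Cassels–Tate on `Sel^(4) × Sel^(2)`
with `m = 1`, engine H mode A): the dichotomy for `Ш(E/ℚ)` and ONE element of exact order `4` that is
not twice an element, `#Ш[4] = 16`, `ord₂ #Ш_an = 4`.
[cite: SwinnertonDyer2013, §1] [cite: Stamminger2005, Thm. 6.2.2 (p. 73)] -/
theorem X5.descentCertificateAt_of_dichotomy (hd : TwoDivisibilityDichotomy W.sha)
    (hη : ∃ η : W.sha, 4 • η = 0 ∧ 2 • η ≠ 0 ∧ ¬ ∃ x : W.sha, 2 • x = η)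
    (hcard : Nat.card (AddSubgroup.torsionBy W.sha 4) = 16)
    {q : ℚ} (hq : shaAn W = (q : ℂ)) (hv : padicValRat 2 q = 4) : X5.DescentCertificateAt W :=
  X5.descentCertificateAt_of_eightDescent W
    (forall_not_divisible_of_stable_four (stable_four_of_dichotomy_of_witness hd hη)) hcard hq hv

/-- **The core's count line from the `4`-descent**: `#Ш[2] = 4` and every element of `Ш[2]` twice an
element of `Ш` (all three non-trivial `2`-coverings lift to ELS `4`-coverings) ⇒ `#Ш[4] = 16`.
[cite: MerrimanSiksekSmart1996, §4] -/
theorem X5.card_sha_four_eq_sixteen (h2 : Nat.card (AddSubgroup.torsionBy W.sha 2) = 4)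
    (hdiv : ∀ y : W.sha, 2 • y = 0 → ∃ x : W.sha, 2 • x = y) :
    Nat.card (AddSubgroup.torsionBy W.sha 4) = 16 :=
  card_torsionBy_four_of_two_divisible h2 hdiv

variable [W.IsElliptic]

/-- **SHARP shape in Selmer currency** (what engines A/B/F print: `t`, `dim Sel^(2)`; plus E's
`Ш[4] = Ш[2]`): with `rank E(ℚ) = r` (`hrank`, at the census pairs `r = r_an` by GZK),
`#E(ℚ)[2] = 2^t`, `#Sel^(2)(E/ℚ) = 2^(r+t+s)`, `Ш[4] = Ш[2]`, `ord₂ #Ш_an = s` ⇒ the datum (the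
count line by tree `card_torsionBy_sha_eq_of_card_selmerGroup`, p193871).
[cite: Cremona1997, §3.6] [cite: Cassels1998, §1] -/
theorem X5.descentCertificateAt_of_selmerTwo {r t s : ℕ} (hrank : W.mordellWeilRank = r)
    (ht : Nat.card (AddSubgroup.torsionBy W.toAffine.Point 2) = 2 ^ t)
    (hSel : Nat.card (W.selmerGroup 2) = 2 ^ (r + t + s))
    (hstab : ∀ x : W.sha, 4 • x = 0 → 2 • x = 0)
    {q : ℚ} (hq : shaAn W = (q : ℂ)) (hv : padicValRat 2 q = s) : X5.DescentCertificateAt W := by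
  -- transport the computable `DecidableEq ℚ` of the binder to the classical one (as in
  -- `Typed/HigherDescentSelmerCertificate.lean`)
  have hinst : (instDecidableEqRat : DecidableEq ℚ) = fun a b => Classical.propDecidable (a = b) :=
    Subsingleton.elim _ _
  rw [hinst] at ht
  have hpos : 0 < 2 ^ r * 2 ^ t := by positivity
  have hcard : Nat.card (AddSubgroup.torsionBy W.sha (2 : ℕ)) = 2 ^ s :=
    card_torsionBy_sha_eq_of_card_selmerGroup W 2 (a := 2 ^ r * 2 ^ t) (c := 2 ^ s)
      (by rw [hrank]; exact_mod_cast congrArg (2 ^ r * ·) ht) hpos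
      (by rw [← pow_add, ← pow_add]; exact_mod_cast hSel)
  exact X5.descentCertificateAt_of_level_one W hstab (by exact_mod_cast hcard) hq hv

end Shapes

/-! ### §4 Class level: the bridge and its converse -/

section ClassLevel

/-- **X5, class level — the DESCENT ROUTE.** Granted Gross–Zagier–Kolyvagin (`hGZK`, bsd.S17:
`rank = r_an` and `Ш` finite in analytic rank `≤ 1`) and the route input "every elliptic `E/ℚ` of
analytic rank `≤ 1` carries a certified descent datum at `2`" (OPEN as a universal statement; per
curve a terminating computation whenever it is run to the end): `BSD(E,2)` for every pair of class X5
in analytic rank `≤ 1`. CONDITIONAL; deletes nothing; X5 stays CONSTRUCTION-SHAPED; per curve the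
input is discharged by the lane's certificates (`Typed/X5DescentRecords.lean`).
[cite: Miller2011LMS, §1 and Def. 1.1] [cite: CreutzMiller2012, Thm. 1.1] -/
theorem X5.bsdp_of_forall_descentCertificate (hGZK : rank_eq_analyticRank_of_analyticRank_le_one)
    (hcert : ∀ (W : WeierstrassCurve ℚ) [W.IsElliptic] [W.IsGloballyMinimal],
      W.analyticRank ≤ 1 → X5.DescentCertificateAt W) :
    ∀ (W : WeierstrassCurve ℚ) [W.IsElliptic] [W.IsGloballyMinimal] (p : ℕ) [Fact p.Prime],
      ClassX5 W p → W.analyticRank ≤ 1 → BSDp W p := by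
  intro W _ _ p _ hX hr
  have hp : p = 2 := hX
  subst hp
  exact X5.bsdp_two_of_descentCertificateAt W hGZK hr (hcert W hr)

/-- **Conversely the class statement hands back the universal datum** (GZK for finiteness): the
route input is EQUIVALENT to X5's class statement, i.e. the route is a faithful localisation, not a
weakening. [cite: Miller2011LMS, Def. 1.1] -/
theorem X5.forall_descentCertificate_of_forall_bsdp_two
    (hGZK : rank_eq_analyticRank_of_analyticRank_le_one)
    (h : ∀ (W : WeierstrassCurve ℚ) [W.IsElliptic] [W.IsGloballyMinimal],
      ClassX5 W 2 → W.analyticRank ≤ 1 → BSDp W 2) :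
    ∀ (W : WeierstrassCurve ℚ) [W.IsElliptic] [W.IsGloballyMinimal],
      W.analyticRank ≤ 1 → X5.DescentCertificateAt W := by
  intro W _ _ hr
  haveI : Finite W.sha := (hGZK W hr).2
  exact X5.descentCertificateAt_of_bsdp_two W (h W rfl hr)

/-- **The typed residue of X5, class-wide, is the universal datum** (GZK): "`∀ E, r_an ≤ 1 →
X5.MissingInputAt E 2`" ⟺ "`∀ E, r_an ≤ 1 → X5.DescentCertificateAt E`". [cite: Miller2011LMS, Def. 1.1] -/
theorem X5.forall_missingInputAt_iff_forall_descentCertificate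
    (hGZK : rank_eq_analyticRank_of_analyticRank_le_one) :
    (∀ (W : WeierstrassCurve ℚ) [W.IsElliptic], W.analyticRank ≤ 1 → Typed.X5.MissingInputAt W 2) ↔
      ∀ (W : WeierstrassCurve ℚ) [W.IsElliptic], W.analyticRank ≤ 1 → X5.DescentCertificateAt W := by
  constructor
  · intro h W _ hr
    exact X5.descentCertificateAt_of_missingInputAt W (hGZK W hr).2 (h W hr)
  · intro h W _ hr
    exact X5.missingInputAt_of_descentCertificateAt W (hGZK W hr).2 (h W hr)

end ClassLevel

end Literature.NumberTheory.EllipticCurves.Rank1Residual.Typed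

end
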